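import Mathlib
import Literature.Analysis.FluidPDE.ChaeAsymptoticallySelfSimilarWeakLimit
import Literature.Analysis.FluidPDE.SuitableWeak

/-!
# Crux `LandauTail.LandauTailBlowup` (stmt-NavierStokesRegularity-1944), line registered:
  stub `landauTail_veryWeak_of_tendsto_L2` — the very weak identity passes to `L²(Q₁)`-limits

Helper file on the proof path of the crux item `stmt-NavierStokesRegularity-1944`
(`Summit.NavierStokesRegularity.NavierStokesRegularity.Theses.LandauTail.LandauTailBlowup`): it
proves the registered stub `landauTail_veryWeak_of_tendsto_L2` (S2).  Along the Navier–Stokes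
blow-up rescalings `u n → U` the pressure-free ("very weak", Koch–Nadirashvili–Seregin–Šverák
2009, §4 (ii)) formulation of Navier–Stokes passes to the limit when the convergence is only known
in `L²` of the unit parabolic cylinder `Q₁ = (-1, 0) × B₁` and the test fields are supported in
`Q₁`: a space–time `L²` variant of the tree's
`Literature.Analysis.FluidPDE.integral_veryWeak_eq_zero_of_tendsto` (sup-in-time `L^q(B_R)`
convergence, Chae 2007, proof of Thm 1.5, arXiv p. 8).  With `F(w) = ⟪w, ∂ₜψ⟫ + ⟪w, (w·∇)ψ⟫ + ⟪w, Δψ⟫`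
the slice estimate `lintegral_veryWeakIntegrand_sub_le` gives
`∫|F(u n)(t) − F(U)(t)| ≤ M e(t) (2|B₁|^{1/2} + e(t) + 2‖U‖_{L²(B₁)})`, `e(t) = ‖u n (t) − U‖_{L²(B₁)}`;
integrating in time, Tonelli (`∫ e² dt = ‖u n − U‖²_{L²(Q₁)}`) and Cauchy–Schwarz in time give
`|∫∫F(u n) − ∫∫F(U)| → 0`, and `∫∫F(u n) = 0` for all `n`.

* `landauTail_eLpNorm_slice_sq` — Tonelli for squared slice `L²` norms;
* `landauTail_lintegral_le_of_sq` — Cauchy–Schwarz against `1`;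
* `landauTail_aestronglyMeasurable_integrand` — measurability of the very weak integrand;
* `landauTail_veryWeak_limit_of_tendsto_eLpNorm` — the limit theorem (general space `E`);
* `landauTail_veryWeak_of_tendsto_L2` — the registered stub (`E = ℝ³`).
-/

set_option linter.dupNamespace false

noncomputable section

open MeasureTheory Set Function Filter Metric TopologicalSpace InnerProductSpace
open scoped NNReal ENNReal Topology RealInnerProductSpace Laplacian ContDiff
open Literature.Analysis.FluidPDE

namespace Summit.NavierStokesRegularity.NavierStokesRegularity.Theorems

/-- **Tonelli for slice `L²` norms.** For a jointly (a.e. strongly) measurable `δ` on a product,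
the slice norms `t ↦ ‖δ(t, ·)‖_{L²(ν)}` are a.e. measurable and
`∫⁻ ‖δ(t, ·)‖²_{L²(ν)} dμ(t) = ‖δ‖²_{L²(μ ⊗ ν)}`. [folklore] -/
theorem landauTail_eLpNorm_slice_sq {α β F : Type*} [MeasurableSpace α] [MeasurableSpace β]
    [NormedAddCommGroup F] {μ : Measure α} {ν : Measure β} [SFinite ν] {δ : α × β → F}
    (hδ : AEStronglyMeasurable δ (μ.prod ν)) :
    AEMeasurable (fun t => eLpNorm (fun x => δ (t, x)) 2 ν) μ ∧
      ∫⁻ t, eLpNorm (fun x => δ (t, x)) 2 ν ^ (2 : ℝ) ∂μ = eLpNorm δ 2 (μ.prod ν) ^ (2 : ℝ) := by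
  have hg : AEMeasurable (fun z => ‖δ z‖ₑ ^ (2 : ℝ)) (μ.prod ν) := hδ.enorm.pow_const _
  have he : ∀ t, eLpNorm (fun x => δ (t, x)) 2 ν =
      (∫⁻ x, ‖δ (t, x)‖ₑ ^ (2 : ℝ) ∂ν) ^ (1 / 2 : ℝ) :=
    fun t => (lintegral_enorm_sq_rpow_half_eq _ _).symm
  have h2 : ∀ a : ℝ≥0∞, (a ^ (1 / 2 : ℝ)) ^ (2 : ℝ) = a := fun a => by
    rw [← ENNReal.rpow_mul]; norm_num
  simp_rw [he]
  refine ⟨hg.lintegral_prod_right'.pow_const _, ?_⟩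
  simp_rw [h2]
  rw [← lintegral_prod _ hg, ← lintegral_enorm_sq_rpow_half_eq δ (μ.prod ν), h2]

/-- **Cauchy–Schwarz against `1`**: `∫⁻ e ≤ (∫⁻ e²)^{1/2} μ(univ)^{1/2}` for an a.e. measurable
`e : α → ℝ≥0∞` (Mathlib `ENNReal.lintegral_mul_le_Lp_mul_Lq`, `p = q = 2`). [folklore] -/
theorem landauTail_lintegral_le_of_sq {α : Type*} [MeasurableSpace α] {μ : Measure α}
    {e : α → ℝ≥0∞} (he : AEMeasurable e μ) :
    ∫⁻ t, e t ∂μ ≤ (∫⁻ t, e t ^ (2 : ℝ) ∂μ) ^ (1 / 2 : ℝ) * μ univ ^ (1 / 2 : ℝ) := by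
  have h := ENNReal.lintegral_mul_le_Lp_mul_Lq μ Real.HolderConjugate.two_two he
    (aemeasurable_const (b := (1 : ℝ≥0∞)))
  simpa only [Pi.mul_apply, mul_one, ENNReal.one_rpow, lintegral_const, one_mul] using h

/-- **Measurability of the very weak integrand** `x ↦ ⟪a x, d x⟫ + ⟪a x, D x (a x)⟫ + ν⟪a x, L x⟫`
for a.e. strongly measurable data (the tree's `aestronglyMeasurable_veryWeakIntegrand` on a
general measure space, so that it applies on space–time). [folklore] -/
theorem landauTail_aestronglyMeasurable_integrand {α F : Type*} [MeasurableSpace α]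
    {μ : Measure α} [NormedAddCommGroup F] [InnerProductSpace ℝ F]
    {a d L : α → F} {D : α → F →L[ℝ] F} {ν : ℝ}
    (ha : AEStronglyMeasurable a μ) (hd : AEStronglyMeasurable d μ)
    (hD : AEStronglyMeasurable D μ) (hL : AEStronglyMeasurable L μ) :
    AEStronglyMeasurable (fun x => ⟪a x, d x⟫ + ⟪a x, D x (a x)⟫ + ν * ⟪a x, L x⟫) μ := by
  have h2 : AEStronglyMeasurable (fun x => D x (a x)) μ := by
    have := ContinuousLinearMap.aestronglyMeasurable_comp₂
      (ContinuousLinearMap.id ℝ (F →L[ℝ] F)) hD ha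
    simpa using this
  exact ((ha.inner hd).add (ha.inner h2)).add ((ha.inner hL).const_mul ν)

section Limit

variable {E : Type*} [NormedAddCommGroup E] [InnerProductSpace ℝ E] [FiniteDimensional ℝ E]
  [MeasurableSpace E] [BorelSpace E]

/-- **Passage to the limit in the very weak formulation under `L²(Q₁)` convergence** (the
space–time `L²` variant of Chae 2007, proof of Thm 1.5, arXiv p. 8, and of the tree's
`integral_veryWeak_eq_zero_of_tendsto`; KNSS 2009, §4 (ii) for the formulation).  Let the fields
`u n` be continuous on the slab `(-1, 0) × E` and satisfy the very weak identity (`ν = 1`) against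
a test field `ψ` supported in the unit parabolic cylinder `Q₁ = (-1, 0) × B(0, 1)`; let
`U ∈ L²(B(0,1))` be measurable and `‖u n − U‖_{L²(Q₁)} → 0`.  Then the time-independent field
`U` satisfies the very weak identity against `ψ`.  Proof: reduce the time integral to a compact
window `(a₁, b₁) ⋐ (-1, 0)` containing the time support of `ψ`; the slice estimate
`lintegral_veryWeakIntegrand_sub_le`, Tonelli and Cauchy–Schwarz in time bound
`‖∫∫F(u n) − ∫∫F(U)‖ₑ` by `M((2|B₁|^{1/2} + 2‖U‖) Eₙ + Eₙ²)`, `Eₙ = ‖u n − U‖_{L²(Q₁)} → 0`.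
(Chae 2007, p. 8; [folklore]) -/
theorem landauTail_veryWeak_limit_of_tendsto_eLpNorm {u : ℕ → ℝ → E → E} {U : E → E}
    {ψ : ℝ → E → E} (huc : ∀ n, ContinuousOn (uncurry (u n)) (Ioo (-1 : ℝ) 0 ×ˢ univ))
    (hψ : IsSpaceTimeTestOn (parabolicCylinderOpens 1 ((0 : ℝ), (0 : E))) ψ)
    (hid : ∀ n, ∫ t in Ioo (-1 : ℝ) 0, ∫ x, (⟪u n t x, timeDeriv ψ t x⟫ +
      ⟪u n t x, convect (u n t) (ψ t) x⟫ + 1 * ⟪u n t x, Δ (ψ t) x⟫) = 0)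
    (hUm : AEStronglyMeasurable U volume)
    (hU2 : eLpNorm U 2 (volume.restrict (ball (0 : E) 1)) < ⊤)
    (hconv : Tendsto (fun n => eLpNorm (fun z : ℝ × E => u n z.1 z.2 - U z.2) 2
      (volume.restrict (Ioo (-1 : ℝ) 0 ×ˢ ball (0 : E) 1))) atTop (𝓝 0)) :
    ∫ t in Ioo (-1 : ℝ) 0, ∫ x, (⟪U x, timeDeriv ψ t x⟫ + ⟪U x, convect U (ψ t) x⟫ +
      1 * ⟪U x, Δ (ψ t) x⟫) = 0 := by
  -- the very weak integrand (`ν = 1`); `U` enters as the time-independent field `fun _ => U`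
  set Fn : (ℝ → E → E) → ℝ → E → ℝ := fun v t x =>
    ⟪v t x, timeDeriv ψ t x⟫ + ⟪v t x, fderiv ℝ (ψ t) x (v t x)⟫ + 1 * ⟪v t x, Δ (ψ t) x⟫
    with hFn
  have hid' : ∀ n, ∫ t in Ioo (-1 : ℝ) 0, ∫ x, Fn (u n) t x = 0 := hid
  show ∫ t in Ioo (-1 : ℝ) 0, ∫ x, Fn (fun _ => U) t x = 0
  -- Step 0: the support of the test field and the time window
  have hQ : ∀ z : ℝ × E, z ∈ (parabolicCylinderOpens 1 ((0 : ℝ), (0 : E)) : Set (ℝ × E)) →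
      z.1 ∈ Ioo (-1 : ℝ) 0 ∧ z.2 ∈ ball (0 : E) 1 := by
    intro z hz
    rw [coe_parabolicCylinderOpens, mem_parabolicCylinder] at hz
    obtain ⟨⟨h1, h2⟩, h3⟩ := hz
    exact ⟨⟨by linarith, by simpa using h2⟩, by simpa [mem_ball] using h3⟩
  have hψ' : IsSpaceTimeTestOn (slab E (Ioo (-1 : ℝ) 0) isOpen_Ioo) ψ :=
    hψ.mono fun z hz => mem_slab.2 (hQ z hz).1
  obtain ⟨a', b', ha', -, hb', hsupp⟩ := hψ'.exists_time_support_Ioo (by norm_num)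
  set a₁ : ℝ := (-1 + a') / 2 with ha₁
  set b₁ : ℝ := b' / 2 with hb₁
  have h1a₁ : -1 < a₁ := by rw [ha₁]; linarith
  have ha₁a' : a₁ < a' := by rw [ha₁]; linarith
  have hb'b₁ : b' < b₁ := by rw [hb₁]; linarith
  have hb₁0 : b₁ < 0 := by rw [hb₁]; linarith
  have hIcc : Icc a₁ b₁ ⊆ Ioo (-1) 0 := fun t ht => ⟨h1a₁.trans_le ht.1, ht.2.trans_lt hb₁0⟩
  have hIoo : Ioo a₁ b₁ ⊆ Ioo (-1) 0 := Ioo_subset_Icc_self.trans hIcc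
  obtain ⟨M, -, hM⟩ := hψ.exists_uniform_bound
  -- the derived test data vanish off `ball 0 1` in space and off `[a', b']` in time
  have hzero_x : ∀ t, ∀ x ∉ ball (0 : E) 1,
      timeDeriv ψ t x = 0 ∧ fderiv ℝ (ψ t) x = 0 ∧ Δ (ψ t) x = 0 := fun t x hx =>
    derived_eq_zero_of_notMem_tsupport fun h => hx (hQ _ (hψ.tsupport_subset h)).2
  have hzero_t : ∀ t, t ∉ Icc a' b' → ∀ x,
      timeDeriv ψ t x = 0 ∧ fderiv ℝ (ψ t) x = 0 ∧ Δ (ψ t) x = 0 := by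
    intro t ht x
    refine derived_eq_zero_of_notMem_tsupport (notMem_tsupport_iff_eventuallyEq.2 ?_)
    have hopen : IsOpen ((Icc a' b')ᶜ ×ˢ (univ : Set E)) :=
      isClosed_Icc.isOpen_compl.prod isOpen_univ
    filter_upwards [hopen.mem_nhds (mk_mem_prod ht (mem_univ x))] with z hz
    have hz1 : z.1 ∉ Icc a' b' := hz.1
    simp only [uncurry, hsupp z.1 hz1, Pi.zero_apply]
  have hFn0_t : ∀ v t, t ∉ Icc a' b' → ∀ x, Fn v t x = 0 := by
    intro v t ht x
    obtain ⟨h1, h2, h3⟩ := hzero_t t ht x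
    simp only [hFn, h1, h2, h3, inner_zero_right, zero_apply, mul_zero, add_zero]
  have hFn0_x : ∀ v t, ∀ x ∉ ball (0 : E) 1, Fn v t x = 0 := by
    intro v t x hx
    obtain ⟨h1, h2, h3⟩ := hzero_x t x hx
    simp only [hFn, h1, h2, h3, inner_zero_right, zero_apply, mul_zero, add_zero]
  -- reduction of the time integral to `(a₁, b₁)`
  have hreduce : ∀ v, ∫ t in Ioo (-1 : ℝ) 0, ∫ x, Fn v t x = ∫ t in Ioo a₁ b₁, ∫ x, Fn v t x := by
    intro v
    refine setIntegral_eq_of_subset_of_forall_sdiff_eq_zero measurableSet_Ioo hIoo fun t ht => ?_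
    have ht' : t ∉ Icc a' b' := fun h' => ht.2 ⟨ha₁a'.trans_le h'.1, h'.2.trans_lt hb'b₁⟩
    simp only [hFn0_t v t ht', integral_zero]
  rw [hreduce]
  simp only [hreduce] at hid'
  -- Step 1: constants and the test data
  set NU : ℝ≥0∞ := eLpNorm U 2 (volume.restrict (ball (0 : E) 1)) with hNU
  have hNUtop : NU ≠ ⊤ := hU2.ne
  set K₁ : ℝ≥0∞ := ENNReal.ofReal (1 + |(1 : ℝ)|) * volume (ball (0 : E) 1) ^ (1 / 2 : ℝ) with hK₁
  have hK₁top : K₁ ≠ ⊤ := ENNReal.mul_ne_top ENNReal.ofReal_ne_top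
    (ENNReal.rpow_ne_top_of_nonneg (by norm_num) measure_ball_lt_top.ne)
  have hK₁NU : K₁ + 2 * NU ≠ ⊤ :=
    ENNReal.add_ne_top.2 ⟨hK₁top, ENNReal.mul_ne_top ENNReal.ofNat_ne_top hNUtop⟩
  have hBU : ENNReal.ofReal M * NU * (K₁ + NU) ≠ ⊤ :=
    ENNReal.mul_ne_top (ENNReal.mul_ne_top ENNReal.ofReal_ne_top hNUtop)
      (ENNReal.add_ne_top.2 ⟨hK₁top, hNUtop⟩)
  have hMt : ∀ t x, ‖timeDeriv ψ t x‖ ≤ M ∧ ‖fderiv ℝ (ψ t) x‖ ≤ M ∧ ‖Δ (ψ t) x‖ ≤ M := hM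
  have c1 : Continuous (uncurry (timeDeriv ψ)) := hψ.continuous_timeDeriv
  have c2 : Continuous fun z : ℝ × E => fderiv ℝ (ψ z.1) z.2 := by
    have := ((hψ.isSmoothSpaceTimeOn univ).fderiv_slice uniqueDiffOn_univ).continuousOn
    rwa [univ_prod_univ, continuousOn_univ] at this
  have c3 : Continuous fun z : ℝ × E => Δ (ψ z.1) z.2 := by
    have := ((hψ.isSmoothSpaceTimeOn univ).laplacian uniqueDiffOn_univ).continuousOn
    rwa [univ_prod_univ, continuousOn_univ] at this
  have cd : ∀ t, Continuous (timeDeriv ψ t) := fun t => c1.comp (Continuous.prodMk_right t)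
  have cD : ∀ t, Continuous fun x => fderiv ℝ (ψ t) x := fun t =>
    c2.comp (Continuous.prodMk_right t)
  have cL : ∀ t, Continuous fun x => Δ (ψ t) x := fun t =>
    continuous_laplacian (contDiff_infty.1 (hψ.contDiff_slice t) 2)
  -- Step 2: slices. (a) the limit slices: a uniform `L¹` bound, integrability in `x` and `(t, x)`
  have hU_lint : ∀ t, ∫⁻ x, ‖Fn (fun _ => U) t x‖ₑ ≤ ENNReal.ofReal M * NU * (K₁ + NU) := fun t =>
    lintegral_veryWeakIntegrand_le (ν := 1) (hMt t) (hzero_x t) hUm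
  have hintU : ∀ t, Integrable (Fn (fun _ => U) t) volume := fun t =>
    ⟨aestronglyMeasurable_veryWeakIntegrand hUm (cd t) (cD t) (cL t),
      hasFiniteIntegral_iff_enorm.2 ((hU_lint t).trans_lt hBU.lt_top)⟩
  have hU_prod : Integrable (fun z : ℝ × E => Fn (fun _ => U) z.1 z.2)
      ((volume.restrict (Ioo a₁ b₁)).prod volume) := by
    have hm : AEStronglyMeasurable (fun z : ℝ × E => Fn (fun _ => U) z.1 z.2)
        ((volume.restrict (Ioo a₁ b₁)).prod volume) :=
      landauTail_aestronglyMeasurable_integrand (ν := 1) hUm.comp_snd c1.aestronglyMeasurable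
        c2.aestronglyMeasurable c3.aestronglyMeasurable
    refine ⟨hm, ?_⟩
    rw [hasFiniteIntegral_iff_enorm, lintegral_prod _ hm.enorm]
    refine lt_of_le_of_lt (lintegral_mono fun t => hU_lint t) ?_
    rw [lintegral_const, Measure.restrict_apply_univ, Real.volume_Ioo]
    exact ENNReal.mul_lt_top hBU.lt_top ENNReal.ofReal_lt_top
  have hFU_int : Integrable (fun t => ∫ x, Fn (fun _ => U) t x) (volume.restrict (Ioo a₁ b₁)) :=
    hU_prod.integral_prod_left
  -- (b) the approximants: continuity on the closed window, integrability of slices and in time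
  have hGcont : ∀ n, ContinuousOn (fun z : ℝ × E => Fn (u n) z.1 z.2) (Icc a₁ b₁ ×ˢ univ) := by
    intro n
    have hu : ContinuousOn (uncurry (u n)) (Icc a₁ b₁ ×ˢ univ) :=
      (huc n).mono (prod_mono hIcc Subset.rfl)
    exact ((hu.inner c1.continuousOn).add (hu.inner (c2.continuousOn.clm_apply hu))).add
      (continuousOn_const.mul (hu.inner c3.continuousOn))
  have hGzero : ∀ v, ∀ t ∈ Icc a₁ b₁, ∀ x ∉ closedBall (0 : E) 1,
      (fun z : ℝ × E => Fn v z.1 z.2) (t, x) = 0 := fun v t _ x hx =>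
    hFn0_x v t x fun h => hx (ball_subset_closedBall h)
  have hslice_cont : ∀ n, ∀ t ∈ Ioo a₁ b₁,
      Continuous (u n t) ∧ Continuous fun x => Fn (u n) t x := by
    intro n t ht
    have hmaps : ∀ x ∈ (univ : Set E), (t, x) ∈ Icc a₁ b₁ ×ˢ (univ : Set E) := fun x _ =>
      mk_mem_prod (Ioo_subset_Icc_self ht) (mem_univ x)
    have h1 : ContinuousOn (fun x => uncurry (u n) (t, x)) univ :=
      ((huc n).mono (prod_mono hIcc Subset.rfl)).comp (Continuous.prodMk_right t).continuousOn
        hmaps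
    have h2 : ContinuousOn (fun x => Fn (u n) t x) univ :=
      (hGcont n).comp (Continuous.prodMk_right t).continuousOn hmaps
    exact ⟨continuousOn_univ.1 h1, continuousOn_univ.1 h2⟩
  have hslice_int : ∀ n, ∀ t ∈ Ioo a₁ b₁, Integrable (fun x => Fn (u n) t x) volume := by
    intro n t ht
    refine (hslice_cont n t ht).2.integrable_of_hasCompactSupport ?_
    exact HasCompactSupport.intro (isCompact_closedBall (0 : E) 1) fun x hx =>
      hGzero (u n) t (Ioo_subset_Icc_self ht) x hx
  have hF_int : ∀ n, Integrable (fun t => ∫ x, Fn (u n) t x) (volume.restrict (Ioo a₁ b₁)) :=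
    fun n => (integrable_prod_of_continuousOn (isCompact_closedBall (0 : E) 1) (hGcont n)
      (hGzero (u n))).integral_prod_left
  -- (c) the deviations: slice `L²` norms `e n t`, space–time norms `En n`, Tonelli, Cauchy–Schwarz
  set e : ℕ → ℝ → ℝ≥0∞ := fun n t => eLpNorm (u n t - U) 2 (volume.restrict (ball (0 : E) 1))
    with he
  set En : ℕ → ℝ≥0∞ := fun n => eLpNorm (fun z : ℝ × E => u n z.1 z.2 - U z.2) 2
    (volume.restrict (Ioo (-1 : ℝ) 0 ×ˢ ball (0 : E) 1)) with hEn
  have hEn0 : Tendsto En atTop (𝓝 0) := hconv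
  have hδm : ∀ n, AEStronglyMeasurable (fun z : ℝ × E => u n z.1 z.2 - U z.2)
      ((volume.restrict (Ioo (-1 : ℝ) 0)).prod (volume.restrict (ball (0 : E) 1))) := by
    intro n
    rw [Measure.prod_restrict]
    have h1 : AEStronglyMeasurable (fun z : ℝ × E => u n z.1 z.2)
        ((volume.prod volume).restrict (Ioo (-1 : ℝ) 0 ×ˢ ball (0 : E) 1)) :=
      ((huc n).mono (prod_mono Subset.rfl (subset_univ _))).aestronglyMeasurable
        (measurableSet_Ioo.prod measurableSet_ball)
    have h2 : AEStronglyMeasurable (fun z : ℝ × E => U z.2)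
        ((volume.prod volume).restrict (Ioo (-1 : ℝ) 0 ×ˢ ball (0 : E) 1)) :=
      hUm.comp_snd.restrict
    exact h1.sub h2
  have hTon : ∀ n, AEMeasurable (e n) (volume.restrict (Ioo (-1 : ℝ) 0)) ∧
      ∫⁻ t in Ioo (-1 : ℝ) 0, e n t ^ (2 : ℝ) = En n ^ (2 : ℝ) := by
    intro n
    have h := landauTail_eLpNorm_slice_sq (hδm n)
    rw [Measure.prod_restrict, ← Measure.volume_eq_prod] at h
    exact h
  have hmeasI : (volume.restrict (Ioo (-1 : ℝ) 0)) univ = 1 := by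
    rw [Measure.restrict_apply_univ, Real.volume_Ioo]; norm_num
  have hroot : ∀ a : ℝ≥0∞, (a ^ (2 : ℝ)) ^ (1 / 2 : ℝ) = a := fun a => by
    rw [← ENNReal.rpow_mul]; norm_num
  have hCS : ∀ n, ∫⁻ t in Ioo (-1 : ℝ) 0, e n t ≤ En n := by
    intro n
    have h := landauTail_lintegral_le_of_sq (hTon n).1
    rwa [(hTon n).2, hmeasI, ENNReal.one_rpow, mul_one, hroot] at h
  have hsq : ∀ n, ∫⁻ t in Ioo (-1 : ℝ) 0, e n t * e n t = En n * En n := by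
    intro n
    have h := (hTon n).2
    simp only [ENNReal.rpow_two, pow_two] at h
    exact h
  -- Step 3: the estimate `‖∫∫ F(u n) - ∫∫ F(U)‖ₑ ≤ B n`
  set B : ℕ → ℝ≥0∞ := fun n => ENNReal.ofReal M * ((K₁ + 2 * NU) * En n + En n * En n) with hB
  have hslice : ∀ n, ∀ t ∈ Ioo a₁ b₁,
      ‖(∫ x, Fn (u n) t x) - ∫ x, Fn (fun _ => U) t x‖ₑ ≤
        ENNReal.ofReal M * ((K₁ + 2 * NU) * e n t + e n t * e n t) := by
    intro n t ht
    rw [← integral_sub (hslice_int n t ht) (hintU t)]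
    refine (enorm_integral_le_lintegral_enorm _).trans ?_
    have hwm : AEStronglyMeasurable (u n t) volume := (hslice_cont n t ht).1.aestronglyMeasurable
    have hlin : ∫⁻ x, ‖Fn (u n) t x - Fn (fun _ => U) t x‖ₑ ≤
        ENNReal.ofReal M * e n t * (K₁ + e n t + 2 * NU) :=
      lintegral_veryWeakIntegrand_sub_le (ν := 1) (hMt t) (hzero_x t) hwm hUm
    refine hlin.trans (le_of_eq ?_)
    ring
  have hbound : ∀ n, ‖∫ t in Ioo a₁ b₁, ∫ x, Fn (fun _ => U) t x‖ₑ ≤ B n := by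
    intro n
    have hmeas : AEMeasurable (fun t => (K₁ + 2 * NU) * e n t) (volume.restrict (Ioo (-1 : ℝ) 0)) :=
      (hTon n).1.const_mul _
    calc ‖∫ t in Ioo a₁ b₁, ∫ x, Fn (fun _ => U) t x‖ₑ
        = ‖(∫ t in Ioo a₁ b₁, ∫ x, Fn (u n) t x) - ∫ t in Ioo a₁ b₁, ∫ x, Fn (fun _ => U) t x‖ₑ := by
          rw [hid' n, zero_sub, enorm_neg]
      _ = ‖∫ t in Ioo a₁ b₁, ((∫ x, Fn (u n) t x) - ∫ x, Fn (fun _ => U) t x)‖ₑ := by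
          rw [integral_sub (hF_int n) hFU_int]
      _ ≤ ∫⁻ t in Ioo a₁ b₁, ‖(∫ x, Fn (u n) t x) - ∫ x, Fn (fun _ => U) t x‖ₑ :=
          enorm_integral_le_lintegral_enorm _
      _ ≤ ∫⁻ t in Ioo a₁ b₁, ENNReal.ofReal M * ((K₁ + 2 * NU) * e n t + e n t * e n t) :=
          setLIntegral_mono' measurableSet_Ioo fun t ht => hslice n t ht
      _ ≤ ∫⁻ t in Ioo (-1 : ℝ) 0, ENNReal.ofReal M * ((K₁ + 2 * NU) * e n t + e n t * e n t) :=
          lintegral_mono_set hIoo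
      _ = ENNReal.ofReal M * ((K₁ + 2 * NU) * (∫⁻ t in Ioo (-1 : ℝ) 0, e n t) +
            ∫⁻ t in Ioo (-1 : ℝ) 0, e n t * e n t) := by
          rw [lintegral_const_mul' _ _ ENNReal.ofReal_ne_top, lintegral_add_left' hmeas,
            lintegral_const_mul' _ _ hK₁NU]
      _ ≤ ENNReal.ofReal M * ((K₁ + 2 * NU) * En n + En n * En n) := by
          rw [hsq n]
          gcongr
          exact hCS n
  -- Step 4: `B n → 0`, hence the integral vanishes
  have hB0 : Tendsto B atTop (𝓝 0) := by
    have h1 : Tendsto (fun n => (K₁ + 2 * NU) * En n) atTop (𝓝 0) := by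
      simpa using ENNReal.Tendsto.const_mul hEn0 (Or.inr hK₁NU)
    have h2 : Tendsto (fun n => En n * En n) atTop (𝓝 0) := by
      simpa using ENNReal.Tendsto.mul hEn0 (Or.inr ENNReal.zero_ne_top) hEn0
        (Or.inr ENNReal.zero_ne_top)
    simpa [hB] using ENNReal.Tendsto.const_mul (h1.add h2) (Or.inr ENNReal.ofReal_ne_top)
  have hle : ‖∫ t in Ioo a₁ b₁, ∫ x, Fn (fun _ => U) t x‖ₑ ≤ 0 := ge_of_tendsto' hB0 hbound
  exact enorm_eq_zero.1 (le_zero_iff.1 hle)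

end Limit

/-- **Registered stub `landauTail_veryWeak_of_tendsto_L2` (S2, crux stmt-NavierStokesRegularity-1944):
the pressure-free very weak Navier–Stokes identity passes to `L²(Q₁)`-limits.**  Along fields
`u n`, continuous on the slab `(-1, 0) × ℝ³` and satisfying the very weak identity (`ν = 1`)
against a test field `ψ` supported in the unit parabolic cylinder `Q₁` with divergence-free
slices, converging to a measurable time-independent `U ∈ L²(B₁)` in `L²(Q₁)`, the limit `U`
satisfies the very weak identity against `ψ` (Chae 2007, proof of Thm 1.5, arXiv p. 8; KNSS 2009,
§4 (ii); by `landauTail_veryWeak_limit_of_tendsto_eLpNorm`). -/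
theorem landauTail_veryWeak_of_tendsto_L2 : ∀ (u : ℕ → ℝ → EuclideanSpace ℝ (Fin 3) → EuclideanSpace ℝ (Fin 3)) (U : EuclideanSpace ℝ (Fin 3) → EuclideanSpace ℝ (Fin 3)) (ψ : ℝ → EuclideanSpace ℝ (Fin 3) → EuclideanSpace ℝ (Fin 3)), (∀ n, ContinuousOn (Function.uncurry (u n)) (Set.Ioo (-1 : ℝ) 0 ×ˢ Set.univ)) → Literature.Analysis.FluidPDE.IsSpaceTimeTestOn (Literature.Analysis.FluidPDE.parabolicCylinderOpens 1 ((0 : ℝ), (0 : EuclideanSpace ℝ (Fin 3)))) ψ → (∀ t, Literature.Analysis.FluidPDE.VectorCalculus.IsDivFree (ψ t)) → (∀ n, ∫ t in Set.Ioo (-1 : ℝ) 0, ∫ x, (inner ℝ (u n t x) (Literature.Analysis.FluidPDE.timeDeriv ψ t x) + inner ℝ (u n t x) (Literature.Analysis.FluidPDE.convect (u n t) (ψ t) x) + 1 * inner ℝ (u n t x) (Laplacian.laplacian (ψ t) x)) = 0) → MeasureTheory.AEStronglyMeasurable U MeasureTheory.volume → MeasureTheory.eLpNorm U 2 (MeasureTheory.volume.restrict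 (Metric.ball (0 : EuclideanSpace ℝ (Fin 3)) 1)) < ⊤ → Filter.Tendsto (fun n => MeasureTheory.eLpNorm (fun z : ℝ × EuclideanSpace ℝ (Fin 3) => u n z.1 z.2 - U z.2) 2 (MeasureTheory.volume.restrict (Set.Ioo (-1 : ℝ) 0 ×ˢ Metric.ball (0 : EuclideanSpace ℝ (Fin 3)) 1))) Filter.atTop (nhds 0) → ∫ t in Set.Ioo (-1 : ℝ) 0, ∫ x, (inner ℝ (U x) (Literature.Analysis.FluidPDE.timeDeriv ψ t x) + inner ℝ (U x) (Literature.Analysis.FluidPDE.convect U (ψ t) x) + 1 * inner ℝ (U x) (Laplacian.laplacian (ψ t) x)) = 0 := by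
  intro u U ψ huc hψ _ hid hUm hU2 hconv
  exact landauTail_veryWeak_limit_of_tendsto_eLpNorm huc hψ hid hUm hU2 hconv

end Summit.NavierStokesRegularity.NavierStokesRegularity.Theorems

end
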